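import Summits.Ventures.PercRepro.ProfileBiIndepNormCons

/-!
# PercRepro — (NC-sep) AND (NCκ): THE NORMALISED CONSECUTIVE STEP FOR THE SEPARATED SETS AND FOR THE CAPTURED FAMILY
(p10, gen 29)

Companions of (NC) (ProfileBiIndepNormCons): the same consecutive normalisation for gen 18's SEPARATED sets
`s_j(U) = #{Z ∈ BI_j : cl Z ∈ U, cl (E ∖ Z) ∉ U}` (`sepCount`) and, at the modular cut of a point `p`, for the CAPTURED family
`κ_j(M, p)` of the pointed line.

* **CONJECTURE (NC-sep)** (`SepNormCons`, NOT asserted): `s_j(U) · P_{j+1} ≤ s_{j+1}(U) · P_j` for every up-set `U` of flats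
  and every `j` — DATA: 0 failures on every up-set of every matroid with `≤ 5` elements (21,465 up-sets at `n = 5`) and on every
  `≤ 2`-generated up-set at `n = 6` (ncsep.py).
* **CONJECTURE (NCκ)** (`CapNormCons`, NOT asserted): `κ_j · P_{j+1}(M ∖ p) ≤ κ_{j+1} · P_j(M ∖ p)` for every pointed matroid
  and every `j` — DATA: 0 failures on every `(M, p)` with `≤ 8` elements (13,318 pointed matroids, 15,158 level tests at
  `n = 8`; kapnc.py).
* THE BRIDGES: **`sepMirror_of_sepNormCons` : (NC-sep) ⟹ (H-gen)** (telescoping through the mirror interval, `P_k = P_{n−k}`),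
  **`capMirror_of_capNormCons` : (NCκ) ⟹ (H)** (the same telescoping on `M ∖ p`), hence `BiIndepPointed` and (C1″)
  (`capLimitPlus_of_capNormCons`); and `capNormCons_of_sepNormCons` : (NC-sep) ⟹ (NCκ) (by `capCount_eq_sepCount_delete_modCut`).
Nothing here asserts (NC-sep), (NCκ), (H-gen) or (H).
-/

open scoped Matroid

namespace PercRepro.Cogirth

open Finset ThmH Skew

variable {α : Type} [DecidableEq α] {M : Matroid α} [M.Finite]

/-! ### The separated-set form -/

/-- **CONJECTURE (NC-sep) (NOT asserted)**: `s_j(U) · P_{j+1} ≤ s_{j+1}(U) · P_j` for every up-set `U` of flats of every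
finite matroid on `α` and every level `j`. -/
def SepNormCons (α : Type) [DecidableEq α] : Prop :=
  ∀ (M : Matroid α) [M.Finite] (U : Finset (Finset α)), UpFlats M U → ∀ j : ℕ,
    sepCount M U j * (biIndepSets M (j + 1)).card ≤ sepCount M U (j + 1) * (biIndepSets M j).card

/-- `s_j(U) ≤ P_j`. -/
theorem sepCount_le_card (U : Finset (Finset α)) (j : ℕ) : sepCount M U j ≤ (biIndepSets M j).card := by
  unfold sepCount
  apply card_le_card
  intro Z hZ
  exact (mem_sepSets_filter_iff.1 hZ).1

/-- `s_j(U) = 0` when `BI_j = ∅`. -/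
theorem sepCount_eq_zero_of_card_eq_zero {U : Finset (Finset α)} {j : ℕ} (h : (biIndepSets M j).card = 0) :
    sepCount M U j = 0 :=
  Nat.eq_zero_of_le_zero (h ▸ sepCount_le_card U j)

/-- The steps of (NC-sep) telescope: `s_k · P_{k′} ≤ s_{k′} · P_k` for `k ≤ k′ ≤ n − k`. -/
theorem sepCount_mul_le_of_steps {U : Finset (Finset α)}
    (hstep : ∀ j, sepCount M U j * (biIndepSets M (j + 1)).card ≤ sepCount M U (j + 1) * (biIndepSets M j).card)
    {k k' : ℕ} (hkk' : k ≤ k') (hk' : k' + k ≤ (gr M).card) :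
    sepCount M U k * (biIndepSets M k').card ≤ sepCount M U k' * (biIndepSets M k).card := by
  rcases Nat.eq_zero_or_pos (biIndepSets M k).card with h0 | hpos
  · rw [sepCount_eq_zero_of_card_eq_zero h0]
    simp
  · obtain ⟨d, rfl⟩ := Nat.exists_eq_add_of_le hkk'
    apply mul_le_mul_of_steps (fun j => sepCount M U j) (fun j => (biIndepSets M j).card) d
    · intro j _ _
      exact hstep j
    · intro j hj hj'
      exact card_biIndepSets_pos_of_pos (by omega) (by omega) hpos

/-- **(NC-sep) ⟹ (H-gen)**: `s_k ≤ s_{n−k}` for `2k < n`. -/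
theorem sepMirror_of_sepNormCons (h : SepNormCons α) : SepMirror α := by
  intro M _ U hU k hk
  have h1 := sepCount_mul_le_of_steps (M := M) (U := U) (h M U hU) (k := k) (k' := (gr M).card - k)
    (by omega) (by omega)
  rw [← card_biIndepSets_symm M (k := k) (by omega)] at h1
  rcases Nat.eq_zero_or_pos (biIndepSets M k).card with h0 | hpos
  · rw [sepCount_eq_zero_of_card_eq_zero h0]
    exact Nat.zero_le _
  · exact Nat.le_of_mul_le_mul_right h1 hpos

/-- (NC-sep) ⟹ (H-gen) in the closure form, hence (PM-flat). -/
theorem biIndepFlatSup_of_sepNormCons (h : SepNormCons α) : BiIndepFlatSup α :=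
  biIndepFlatSup_iff_sepMirror.2 (sepMirror_of_sepNormCons h)

/-! ### The captured-family form -/

/-- **CONJECTURE (NCκ) (NOT asserted)**: for every pointed finite matroid `(M, p)` on `α` and every level `j`,
`κ_j · P_{j+1}(M ∖ p) ≤ κ_{j+1} · P_j(M ∖ p)`. -/
def CapNormCons (α : Type) [DecidableEq α] : Prop :=
  ∀ (M : Matroid α) [M.Finite] (p : α), p ∈ gr M → ∀ j : ℕ,
    capCount M j p * (biIndepSets (M ＼ ({p} : Set α)) (j + 1)).card ≤
      capCount M (j + 1) p * (biIndepSets (M ＼ ({p} : Set α)) j).card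

/-- (NC-sep) ⟹ (NCκ): the captured family is the separated family of the modular cut in the deletion. -/
theorem capNormCons_of_sepNormCons (h : SepNormCons α) : CapNormCons α := by
  intro M _ p hp j
  rw [capCount_eq_sepCount_delete_modCut hp, capCount_eq_sepCount_delete_modCut hp]
  exact h (M ＼ ({p} : Set α)) (modCut M p) (upFlats_modCut p) j

/-- **(NCκ) ⟹ (H)**: `κ_k ≤ κ_{N−1−k}` for `2k + 2 ≤ N`, by the telescoping on the deletion `M ∖ p` (`N − 1` elements). -/
theorem capMirror_of_capNormCons (h : CapNormCons α) : CapMirror α := by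
  intro M _ p k hp hk
  have hN := card_gr_delete (M := M) hp
  have hstep : ∀ j, sepCount (M ＼ ({p} : Set α)) (modCut M p) j *
      (biIndepSets (M ＼ ({p} : Set α)) (j + 1)).card ≤
      sepCount (M ＼ ({p} : Set α)) (modCut M p) (j + 1) * (biIndepSets (M ＼ ({p} : Set α)) j).card := by
    intro j
    rw [← capCount_eq_sepCount_delete_modCut hp, ← capCount_eq_sepCount_delete_modCut hp]
    exact h M p hp j
  have h1 := sepCount_mul_le_of_steps (M := M ＼ ({p} : Set α)) (U := modCut M p) hstep (k := k)
    (k' := (gr (M ＼ ({p} : Set α))).card - k) (by omega) (by omega)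
  rw [← card_biIndepSets_symm (M ＼ ({p} : Set α)) (k := k) (by omega), hN,
    show (gr M).card - 1 - k = (gr M).card - (k + 1) by omega,
    ← capCount_eq_sepCount_delete_modCut hp, ← capCount_eq_sepCount_delete_modCut hp] at h1
  rcases Nat.eq_zero_or_pos (biIndepSets (M ＼ ({p} : Set α)) k).card with h0 | hpos
  · have : capCount M k p = 0 := by
      rw [capCount_eq_sepCount_delete_modCut hp]
      exact sepCount_eq_zero_of_card_eq_zero h0
    rw [this]
    exact Nat.zero_le _
  · exact Nat.le_of_mul_le_mul_right h1 hpos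

/-- (NCκ) ⟹ the per-point form `out_k ≤ in_{k+1}` of Theorem A. -/
theorem biIndepPointed_of_capNormCons (h : CapNormCons α) : BiIndepPointed α :=
  biIndepPointed_iff_capMirror.2 (capMirror_of_capNormCons h)

/-- (NCκ) ⟹ (C1″). -/
theorem capLimitPlus_of_capNormCons (h : CapNormCons α) : CapLimitPlus α :=
  capLimitPlus_of_capMirror (capMirror_of_capNormCons h)

end PercRepro.Cogirth
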